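import Literature.NumberTheory.EllipticCurves.NewformPadicIntegralModel
import Literature.NumberTheory.DiophantineGeometry.LocalReduction
import HarnessLib

/-!
# The level of a newform congruent to an elliptic curve is divisible by the curve's additive primes
# (Carayol 1986 ∕ 1989, Livné 1989: `N(ρ̄) ∣ N_g`, read at an additive place of `E`, where `ρ̄_{E,p}` is
# ramified for every odd `p`; Darmon–Diamond–Taylor 1995, Thm. 3.1 (d) and its mod `ℓ` form, Prop. 2.6 (b), §2.1)

Topic `NumberTheory/EllipticCurves`; namespace `Literature.NumberTheory.EllipticCurves`. ONE named fact
(`def … : Prop`, nothing asserted, nothing admitted) + its `Iff.rfl` unfolding lemma. Typed by the prover seat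
bsd-line-er5-p2 (width seat -w3 of the line on crux stmt-BirchSwinnertonDyer-19064 `X11aLowerHalf`; cell home
`run/shared/lean/pub/bsd-stepL/line-er5-p2/`) as the LOWER-BOUND companion of the tree's optimal-level facts at
`p = 3` (`ribet1990_levelLowering_gamma0_newform_at_three_additiveDrop` and its siblings, module
`LevelLoweringGamma0AtThreeAdditiveDrop`: those PRODUCE a newform of the optimal level `N(ρ̄)·3^δ`; this one says
that NO congruent newform has level prime to an additive prime of the curve). Consumer: the existence of a
good-ordinary member of the Hida family `H(E[3])` whose level is EXACTLY divisible by a Kodaira-`IV`/`IV*` prime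
(`Summits/BirchSwinnertonDyer/BirchSwinnertonDyer/Theorems/PrintX11aLowerHalfThreeKodairaMember.lean`).

## The statement, and why every clause is in print

Let `E/ℚ` be an elliptic curve (globally minimal model `W`, conductor `N`), `p` an ODD prime with `E[p]`
irreducible, `v` a place of ADDITIVE reduction of `E` with residue characteristic `p_v ≠ p`, and
`g ∈ S_k(Γ₀(M))` (`k ≥ 2`) a newform with a ring map `ι : K_g → ℚ̄_p` of its coefficient field such that
`|ι(a_ℓ(g)) − a_ℓ(E)|_p < 1` for every prime `ℓ ∤ N·M·p`. Then `p_v ∣ M`.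

1. (Deligne 1971; Deligne–Serre Thm. 6.1, the tree's `DeligneSerre1974.thm61_exists_adicGaloisRep`, any weight
   `k ≥ 2`.) The `λ`-adic representation `ρ_{g,λ}` of `g` at the place `λ` of `K_g` under `ι` is unramified at every
   prime `ℓ ∤ M·p`, with `tr ρ_{g,λ}(Frob_ℓ) = a_ℓ(g)` [cite: DeligneSerreASENS1974, Thm. 6.1 (p. 520)]
   [cite: Deligne1971Bourbaki355]; by Carayol's theorem its conductor is exactly `M` [cite: Carayol1986, Thm. (A)]
   [cite: DarmonDiamondTaylor1995, Thm. 3.1 (a), (d) (pp. 85–86; weight two, `J₁(N)`)].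
2. (Brauer–Nesbitt with Chebotarev: "a semi-simple mod `ℓ` representation … if `ℓ > d` … is determined by
   `tr ρ(Frob_p)` on the primes `p ∉ S` at which `ρ` is unramified" [cite: DarmonDiamondTaylor1995, Prop. 2.6 (b)
   (pp. 53–54)].) The hypothesis says `tr ρ̄_{g,λ}(Frob_ℓ) = a_ℓ(E) = tr ρ̄_{E,p}(Frob_ℓ)` in `𝔽̄_p` for all
   `ℓ ∤ N·M·p`, so (`p > 2 = d`) the semisimplification of `ρ̄_{g,λ}` is `ρ̄_{E,p} ⊗ 𝔽̄_p` — `ρ̄_{E,p}` being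
   irreducible, hence absolutely irreducible as `p` is odd (loc. cit. p. 87: "if `ℓ` is odd, one checks using (b)
   that `ρ̄` is irreducible if and only if it is absolutely irreducible"). Hence `ρ̄_{E,p}` is unramified at every
   prime not dividing `M·p`; in conductor language `N(ρ̄_{E,p}) = N(ρ̄_{g,λ})` divides the prime-to-`p` part of `M`
   — the mod `ℓ` form of Thm. 3.1 (d): "In (d) one only has divisibility of the prime-to-`ℓ` part of `N_f` by `N(ρ̄)`
   in general … Carayol [Ca2] and Livné [Liv]" [cite: DarmonDiamondTaylor1995, p. 87] [cite: Carayol1989]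
   [cite: Livne1989] (`m_q(ρ̄) = 0` iff `ρ̄` is unramified at `q` [cite: DarmonDiamondTaylor1995, §2.1 (p. 54)]).
3. (`ρ̄_{E,p}` IS ramified at an additive place `v ∤ p`, `p` odd.) `E[p]^{I_v} = E(ℚ_v^{nr})[p]` injects into
   `Φ_v(𝔽̄_v)[p]`, because `E₀(ℚ_v^{nr})` is uniquely `p`-divisible at an additive place (`Ẽ_ns(𝔽̄_v) = 𝔾_a` and the
   formal group is pro-`p_v`) [cite: SilvermanAEC2009, Prop. VII.2.1, Prop. IV.3.2 (b), Prop. III.2.5]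
   [cite: SilvermanATAEC1994, Cor. IV.9.2 (b), (d)], and the component group of an additive fibre has order `≤ 4`
   [cite: SilvermanATAEC1994, Table 4.1 (p. 365) with Cor. IV.9.2 (d)]; so `#E[p]^{I_v} ≤ 4 < p² = #E[p]`, i.e.
   `ρ̄_{E,p}` is ramified at `v` and `m_{p_v}(ρ̄_{E,p}) ≥ 1`
   (the same computation gives Serre's exponent `f_v − dim E[p]^{I_v}` used VERBATIM by the sibling fact
   `ribet1990_levelLowering_gamma0_newform_at_three_additiveDrop` [cite: DarmonDiamondTaylor1995, Lemma 2.7]).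
Combining 2 and 3 (with `p_v ≠ p`): `p_v ∣ M`.

PRINT vs. TREE: the printed theorem is `N(ρ̄_{g,λ}) ∣ M` for the Artin conductor `N(ρ̄)` of the mod-`p`
representation (Carayol 1986 + Livné 1989, as recorded in Darmon–Diamond–Taylor Thm. 3.1 (d), p. 87); the tree has
no Artin conductor of a mod-`p` representation, so the fact is typed at the one kind of place where the exponent is
known to be positive from the curve alone — an additive place — and in the Fourier-coefficient currency of the tree's
Hida-family members (`IsOrdinaryMemberOfLevel`: `|ι(a_ℓ(g)) − a_ℓ(E)|_p < 1` off the levels).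
-- TODO(general form): `N(ρ̄_{g,λ}) ∣ M` (Carayol 1986 Thm. (A), Livné 1989), for the Artin conductor of any mod-`p`
-- reduction of `ρ_{g,λ}`; and the multiplicative analogue (`q ∥ N`, `p ∤ ord_q Δ` ⇒ `q ∣ M`, DDT Prop. 2.12 (c)).

## References

* H. Carayol, *Sur les représentations ℓ-adiques associées aux formes modulaires de Hilbert*, Ann. Sci. ÉNS 19
  (1986), Thm. (A). [Carayol1986] H. Carayol, Duke Math. J. 59 (1989). [Carayol1989]
* R. Livné, *On the conductors of mod ℓ Galois representations coming from modular forms*, J. Number Theory 31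
  (1989), 133–141. [Livne1989]
* H. Darmon, F. Diamond, R. Taylor, *Fermat's Last Theorem*, CDM 1995, 1–154: §2.1 (p. 54), Prop. 2.6 (b)
  (pp. 53–54), Lemma 2.7, Thm. 3.1 (a), (d) (pp. 85–86) and the mod `ℓ` discussion p. 87 (held text
  `paper:doi-10-4310-cdm-1995-v1995-n1-a1`, pages as in that text). [DarmonDiamondTaylor1995]
* P. Deligne, Sém. Bourbaki 355 (1971). [Deligne1971Bourbaki355] P. Deligne, J.-P. Serre, Ann. Sci. ÉNS 7 (1974),
  Thm. 6.1. [DeligneSerreASENS1974]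
* J. H. Silverman, *Advanced Topics*, GTM 151 (1994), Cor. IV.9.2, Table 4.1. [SilvermanATAEC1994]
  J. H. Silverman, *AEC* 2nd ed. (2009), III.2.5, IV.3.2, VII.2.1. [SilvermanAEC2009]
-/

noncomputable section

open scoped MatrixGroups ModularForm

open CongruenceSubgroup UpperHalfPlane WeierstrassCurve IsDedekindDomain Rat.HeightOneSpectrum
  Literature.NumberTheory.EllipticCurves.ModularForms Literature.NumberTheory.GaloisRepresentations

namespace Literature.NumberTheory.EllipticCurves

/-- **An additive prime of `E` divides the level of every newform congruent to `E` modulo an odd prime `p` with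
`E[p]` irreducible** (Carayol 1986 Thm. (A) + Livné 1989: `N(ρ̄_{E,p}) ∣ M`, Darmon–Diamond–Taylor Thm. 3.1 (d) in
its mod `ℓ` form, read at an additive place `v ∤ p`, where `E[p]^{I_v} ↪ Φ_v(𝔽̄_v)[p]` has order `≤ 4 < p²` so
that `ρ̄_{E,p}` is ramified; see the module docstring). For a globally minimal elliptic `W/ℚ`, an odd prime `p`
with `HasIrreducibleModPGaloisRep`, a place `v` of `ℤ` of additive reduction with `p_v ≠ p`, a newform
`g ∈ S_k(Γ₀(M))`, `k ≥ 2`, and `ι : K_g →+* ℚ̄_p` with `‖ι(a_ℓ(g)) − a_ℓ(W)‖ < 1` for every prime `ℓ ∤ N_W·M·p`: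
`p_v ∣ M`. A `Prop`-valued definition; nothing asserted.
[cite: Carayol1986, Thm. (A)] [cite: Carayol1989] [cite: Livne1989]
[cite: DarmonDiamondTaylor1995, Thm. 3.1 (a), (d) (pp. 85–86), p. 87, Prop. 2.6 (b) (pp. 53–54), §2.1 (p. 54), Lemma 2.7]
[cite: DeligneSerreASENS1974, Thm. 6.1 (p. 520)] [cite: SilvermanATAEC1994, Cor. IV.9.2 (b), (d) and Table 4.1 (p. 365)]
[cite: SilvermanAEC2009, Prop. VII.2.1, Prop. IV.3.2 (b), Prop. III.2.5] -/
def carayolLivne_additivePrime_dvd_level_of_congruent_newform : Prop :=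
  ∀ (W : WeierstrassCurve ℚ) [W.IsElliptic] [W.IsGloballyMinimal] (p : ℕ) [Fact p.Prime], p ≠ 2 →
    W.HasIrreducibleModPGaloisRep p →
    ∀ (v : HeightOneSpectrum ℤ), W.HasAdditiveReductionAt v → natGenerator v ≠ p →
    ∀ {M : ℕ} [NeZero M] {k : ℤ} (g : CuspForm (Gamma0 M) k) (ι : coeffField g →+* PadicAlgCl p),
      2 ≤ k → IsNewform0 g →
      (∀ ℓ : ℕ, ℓ.Prime → ¬ ℓ ∣ W.conductorNorm ℤ * M * p →
        ‖ι ⟨(qExpansion 1 ⇑g).coeff ℓ, coeff_mem_coeffField g ℓ⟩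
            - ((W.frobeniusTrace ℓ : ℤ) : PadicAlgCl p)‖ < 1) →
      natGenerator v ∣ M

/-- Unfolding lemma (the fact is a `Prop`-valued definition; this is its statement).
[cite: DarmonDiamondTaylor1995, Thm. 3.1 (d) and p. 87] [cite: Carayol1986, Thm. (A)] [cite: Livne1989] -/
theorem carayolLivne_additivePrime_dvd_level_of_congruent_newform_iff :
    carayolLivne_additivePrime_dvd_level_of_congruent_newform ↔
      ∀ (W : WeierstrassCurve ℚ) [W.IsElliptic] [W.IsGloballyMinimal] (p : ℕ) [Fact p.Prime], p ≠ 2 →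
        W.HasIrreducibleModPGaloisRep p →
        ∀ (v : HeightOneSpectrum ℤ), W.HasAdditiveReductionAt v → natGenerator v ≠ p →
        ∀ {M : ℕ} [NeZero M] {k : ℤ} (g : CuspForm (Gamma0 M) k) (ι : coeffField g →+* PadicAlgCl p),
          2 ≤ k → IsNewform0 g →
          (∀ ℓ : ℕ, ℓ.Prime → ¬ ℓ ∣ W.conductorNorm ℤ * M * p →
            ‖ι ⟨(qExpansion 1 ⇑g).coeff ℓ, coeff_mem_coeffField g ℓ⟩
                - ((W.frobeniusTrace ℓ : ℤ) : PadicAlgCl p)‖ < 1) →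
          natGenerator v ∣ M :=
  Iff.rfl

end Literature.NumberTheory.EllipticCurves

end
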